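import Summits.ValiantsHypothesis.ValiantsHypothesis.Theorems.LacunarySymmetroidMatrixDescartesWLawTwoSignBudgets
import Summits.ValiantsHypothesis.ValiantsHypothesis.Theorems.LacunarySymmetroidMatrixDescartesWLawDefs

/-!
# `MatrixDescartes` (stmt-ValiantsHypothesis-18050) — the W-law at `n = 2`: CHAMBER LAW by clustered sign budgets
# (`Z₊ ≤ 6` off one exponent chamber, `Z₊ ≤ 4` on another, `6 ≤ w(2) ≤ 8` overall)

HONEST FRAMING.  Cell `pub-symmetroid`, seat `val-sym-mdr-p1` (gen 4); helper `--supports` the crux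
`Theses.LacunarySymmetroid.MatrixDescartes` (OPEN), NO closure claim.  The typed W-law of `…WLawDefs`
(`WLawAt n B`: every `n × n` W-configuration `X^e J + X^{d₁} P₁ + X^{d₂} P₂ + X^{d₃} Q`, `d₂ < d₁ < e < d₃`,
`J` symmetric, `P₁, P₂, Q ⪰ 0`, has `Z₊ ≤ B`; candidate `WLaw : ∀ n, WLawAt n (3n)`, smallest open instance `n = 2`,
kernel floor `6` by `WLawTwoWitness`) is settled here at `n = 2` UP TO ONE EXPONENT CHAMBER:

* `wLawTwo_posRoots_le_six_of_not_chamber` — **`Z₊ ≤ 6 = 3·2` unless `e + d₂ < 2d₁ ∧ d₁ + e < d₂ + d₃ ∧ d₂ + d₃ < 2e`**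
  (in gap form `a < g < c < a + g` with `a = e − d₁`, `g = d₁ − d₂`, `c = d₃ − e`);
* `wLawTwo_posRoots_le_four_of_chamber` — **`Z₊ ≤ 4 = 2·2` whenever `d₁ + e ≤ d₂ + d₃` and `d₁ + d₃ ≤ 2e`** (`g ≤ c ≤ a`);
* `wLawAt_two_eight : WLawAt 2 8` (corollary of the tree's `Pivot.TwoDescartes.pivotTwo_posRoots_le`, conjb-1 g0) and
  `not_wLawAt_two_five : ¬ WLawAt 2 5` (the tree witness has six roots), so the `n = 2` constant lies in `{6, 7, 8}` and a
  seventh root, if it exists, lives in the chamber `a < g < c < a + g` (e.g. exponents `(0, 3 | 5 | 9)`).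

MECHANISM (`2 × 2`, any pivot `J`): by the tree's mixed-discriminant sign lemma (`Pivot.TwoDescartes.coeff_det_nonneg_of_not_mem`)
a negative coefficient of `det F` sits at one of the four PIVOT exponents `e + d₂ < e + d₁ < 2e < e + d₃`, and a
coefficient vanishes at every degree that is not a sum of two letter exponents (`coeff_det_eq_zero_of_forall_ne`).  The new
combinatorial input is a CLUSTERED NEGATIVE BUDGET for Descartes' rule (`signVariations_pair_budget`,
`signVariations_two_pairs_budget`): if the negative coefficients of a real polynomial are confined to a set `T` and two
members `u < v` of `T` have no non-zero coefficient strictly between them, then `Var ≤ 2·#T − 2` (two such disjoint pairs: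
`2·#T − 4`) — proved by splitting the coefficient sequence at `v` (tree `Census.signVariations_add_X_pow_mul`) and a
two-ended form of the budget `Var + [lead < 0] + [trail < 0] ≤ 2·#negSupp` (`signVariations_twoEnded_budget`).  For the
W-pencil, two pivot exponents are adjacent in this sense exactly when no pair-sum `dᵢ + dⱼ` separates them, which is the
chamber arithmetic above.  Nothing here decides the chamber `a < g < c < a + g` (signs allow `8` there; magnitudes
undecided), and nothing bears on `WLaw` for `n ≥ 3`, on `MatrixDescartes` in its window, `DoorA26`/`DoorA34`, or `VP ≠ VNP`.

[folklore] Descartes' rule of signs (Mathlib `Polynomial.roots_countP_pos_le_signVariations`) with sign bookkeeping; no source.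
-/

-- `Summit.ValiantsHypothesis.ValiantsHypothesis.…` repeats a component by the D-0017 layout
-- (single-conjunct summit), which the `dupNamespace` linter flags; the name is mandated.
set_option linter.dupNamespace false

namespace Summit.ValiantsHypothesis.ValiantsHypothesis.Theorems.LacunarySymmetroidMatrixDescartes

open Polynomial Finset
open scoped BigOperators

namespace WLawTwoChambers

/-! ## 2. The `2 × 2` pivot pencil: vanishing coefficients away from pair sums -/

section Pencil

open Pivot.TwoDescartes (letter expo agg coeff_det agg_eq_zero coeff_det_nonneg_of_not_mem pencil_eq_sum)

variable {K : ℕ}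

/-- A coefficient of `det F` vanishes at every degree that is not a sum of two letter exponents. [folklore] -/
theorem coeff_det_eq_zero_of_forall_ne (e : ℕ) (d : Fin K → ℕ) (J : Matrix (Fin 2) (Fin 2) ℝ)
    (P : Fin K → Matrix (Fin 2) (Fin 2) ℝ) (n : ℕ) (hn : ∀ l l', expo e d l + expo e d l' ≠ n) :
    (Matrix.det (∑ l, ((X : ℝ[X]) ^ expo e d l) • (letter J P l).map Polynomial.C)).coeff n = 0 := by
  rw [coeff_det]
  refine Finset.sum_eq_zero fun x hx => ?_
  obtain ⟨a, b⟩ := x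
  replace hx : a + b = n := by simpa using hx
  by_cases ha : ∃ l, expo e d l = a
  · obtain ⟨l, hl⟩ := ha
    have hb : ∀ l', expo e d l' ≠ b := fun l' hl' => hn l l' (by rw [hl, hl', hx])
    rw [agg_eq_zero e d J P b hb]
    simp
  · push Not at ha
    rw [agg_eq_zero e d J P a ha]
    simp

/-- the four PIVOT degrees `e + expo l` as a finset -/
theorem neg_mem_image (e : ℕ) (d : Fin K → ℕ) (J : Matrix (Fin 2) (Fin 2) ℝ) (P : Fin K → Matrix (Fin 2) (Fin 2) ℝ)
    (hP : ∀ k, (P k).PosSemidef) (n : ℕ)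
    (hn : (Matrix.det (∑ l, ((X : ℝ[X]) ^ expo e d l) • (letter J P l).map Polynomial.C)).coeff n < 0) :
    n ∈ (Finset.univ : Finset (Option (Fin K))).image (fun l => e + expo e d l) := by
  classical
  by_contra hnot
  have hn' : ∀ l, e + expo e d l ≠ n := fun l hl => hnot (Finset.mem_image.mpr ⟨l, Finset.mem_univ _, hl⟩)
  exact absurd hn (not_lt.mpr (coeff_det_nonneg_of_not_mem e d J P hP n hn'))

end Pencil

/-! ## 3. The W-pencil at `n = 2` -/

section WPencil

open Pivot.TwoDescartes (letter expo pencil_eq_sum)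

variable (e d₁ d₂ d₃ : ℕ) (J P₁ P₂ Q : Matrix (Fin 2) (Fin 2) ℝ)

/-- The W-pencil in the tree's pivot form `X^e J + ∑ₖ X^{dₖ} Pₖ` with `d = (d₁, d₂, d₃)`, `P = (P₁, P₂, Q)`. -/
theorem wPencil_eq :
    ((X : ℝ[X]) ^ e) • J.map Polynomial.C + ((X : ℝ[X]) ^ d₁) • P₁.map Polynomial.C
        + ((X : ℝ[X]) ^ d₂) • P₂.map Polynomial.C + ((X : ℝ[X]) ^ d₃) • Q.map Polynomial.C
      = ((X : ℝ[X]) ^ e) • J.map Polynomial.C + ∑ k : Fin 3, ((X : ℝ[X]) ^ (![d₁, d₂, d₃] k)) • ((![P₁, P₂, Q] k).map Polynomial.C) := by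
  simp only [Fin.sum_univ_three, Matrix.cons_val_zero, Matrix.cons_val_one, Matrix.cons_val_two,
    Matrix.head_cons, Matrix.tail_cons, add_assoc]

/-- The set of the four pivot degrees `{e + d₂, e + d₁, 2e, e + d₃}` has at most four elements. -/
theorem card_pivotDegrees_le : (({e + d₂, e + d₁, e + e, e + d₃} : Finset ℕ)).card ≤ 4 := by
  refine (Finset.card_insert_le _ _).trans ?_
  refine Nat.succ_le_succ ((Finset.card_insert_le _ _).trans ?_)
  refine Nat.succ_le_succ ((Finset.card_insert_le _ _).trans ?_)
  rw [Finset.card_singleton]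

variable {e d₁ d₂ d₃ J P₁ P₂ Q}

/-- Negative coefficients of the W-determinant sit at pivot degrees. -/
theorem wPencil_neg_mem (hP₁ : P₁.PosSemidef) (hP₂ : P₂.PosSemidef) (hQ : Q.PosSemidef) (n : ℕ)
    (hn : (Matrix.det (∑ l, ((X : ℝ[X]) ^ expo e ![d₁, d₂, d₃] l) • (letter J ![P₁, P₂, Q] l).map Polynomial.C)).coeff n
      < 0) : n ∈ ({e + d₂, e + d₁, e + e, e + d₃} : Finset ℕ) := by
  classical
  have hP : ∀ k : Fin 3, ((![P₁, P₂, Q] : Fin 3 → Matrix (Fin 2) (Fin 2) ℝ) k).PosSemidef := by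
    intro k
    fin_cases k
    · simpa using hP₁
    · simpa using hP₂
    · simpa using hQ
  have h := neg_mem_image e ![d₁, d₂, d₃] J ![P₁, P₂, Q] hP n hn
  rw [Finset.mem_image] at h
  obtain ⟨l, _, hl⟩ := h
  simp only [Finset.mem_insert, Finset.mem_singleton]
  rcases l with _ | l
  · simp only [expo] at hl; omega
  · fin_cases l <;> simp [expo] at hl <;> omega

/-- Abbreviation-free statement of the count of the W-pencil's distinct positive roots. -/
theorem wPencil_posRoots_eq :
    ((Matrix.det (((X : ℝ[X]) ^ e) • J.map Polynomial.C + ((X : ℝ[X]) ^ d₁) • P₁.map Polynomial.C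
        + ((X : ℝ[X]) ^ d₂) • P₂.map Polynomial.C + ((X : ℝ[X]) ^ d₃) • Q.map Polynomial.C)).roots.toFinset.filter
          (fun t => 0 < t)).card
      = ((Matrix.det (∑ l, ((X : ℝ[X]) ^ expo e ![d₁, d₂, d₃] l) •
          (letter J ![P₁, P₂, Q] l).map Polynomial.C)).roots.toFinset.filter (fun t => 0 < t)).card := by
  rw [wPencil_eq, pencil_eq_sum]

/-- **Pair form of the chamber law.**  If two pivot degrees `u < v` have no pair-sum of letter exponents strictly
between them, the W-determinant has at most `6` distinct positive roots. -/
theorem wPencil_posRoots_le_six_of_pair (hP₁ : P₁.PosSemidef) (hP₂ : P₂.PosSemidef) (hQ : Q.PosSemidef)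
    (u v : ℕ) (huv : u < v) (hu : u ∈ ({e + d₂, e + d₁, e + e, e + d₃} : Finset ℕ)) (hv : v ∈ ({e + d₂, e + d₁, e + e, e + d₃} : Finset ℕ))
    (hgap : ∀ l l' : Option (Fin 3), ¬ (u < expo e ![d₁, d₂, d₃] l + expo e ![d₁, d₂, d₃] l' ∧
      expo e ![d₁, d₂, d₃] l + expo e ![d₁, d₂, d₃] l' < v)) :
    ((Matrix.det (((X : ℝ[X]) ^ e) • J.map Polynomial.C + ((X : ℝ[X]) ^ d₁) • P₁.map Polynomial.C
        + ((X : ℝ[X]) ^ d₂) • P₂.map Polynomial.C + ((X : ℝ[X]) ^ d₃) • Q.map Polynomial.C)).roots.toFinset.filter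
          (fun t => 0 < t)).card ≤ 6 := by
  rw [wPencil_posRoots_eq]
  set F := Matrix.det (∑ l, ((X : ℝ[X]) ^ expo e ![d₁, d₂, d₃] l) • (letter J ![P₁, P₂, Q] l).map Polynomial.C)
    with hF
  have hT : ∀ n, F.coeff n < 0 → n ∈ ({e + d₂, e + d₁, e + e, e + d₃} : Finset ℕ) := fun n hn => wPencil_neg_mem hP₁ hP₂ hQ n hn
  have hgap' : ∀ m, u < m → m < v → F.coeff m = 0 := fun m hm1 hm2 =>
    coeff_det_eq_zero_of_forall_ne e _ J _ m fun l l' hm => hgap l l' ⟨by omega, by omega⟩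
  have h1 := signVariations_pair_budget F _ hT u v huv hu hv hgap'
  have h2 := card_posRoots_le_signVariations F
  have h3 := card_pivotDegrees_le e d₁ d₂ d₃
  omega

/-- **Two-pairs form of the chamber law**: two disjoint adjacent pairs of pivot degrees give at most `4` roots. -/
theorem wPencil_posRoots_le_four_of_pairs (hP₁ : P₁.PosSemidef) (hP₂ : P₂.PosSemidef) (hQ : Q.PosSemidef)
    (u₁ v₁ u₂ v₂ : ℕ) (h₁ : u₁ < v₁) (h₁₂ : v₁ < u₂) (h₂ : u₂ < v₂)
    (hu₁ : u₁ ∈ ({e + d₂, e + d₁, e + e, e + d₃} : Finset ℕ)) (hv₁ : v₁ ∈ ({e + d₂, e + d₁, e + e, e + d₃} : Finset ℕ))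
    (hu₂ : u₂ ∈ ({e + d₂, e + d₁, e + e, e + d₃} : Finset ℕ)) (hv₂ : v₂ ∈ ({e + d₂, e + d₁, e + e, e + d₃} : Finset ℕ))
    (hgap₁ : ∀ l l' : Option (Fin 3), ¬ (u₁ < expo e ![d₁, d₂, d₃] l + expo e ![d₁, d₂, d₃] l' ∧
      expo e ![d₁, d₂, d₃] l + expo e ![d₁, d₂, d₃] l' < v₁))
    (hgap₂ : ∀ l l' : Option (Fin 3), ¬ (u₂ < expo e ![d₁, d₂, d₃] l + expo e ![d₁, d₂, d₃] l' ∧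
      expo e ![d₁, d₂, d₃] l + expo e ![d₁, d₂, d₃] l' < v₂)) :
    ((Matrix.det (((X : ℝ[X]) ^ e) • J.map Polynomial.C + ((X : ℝ[X]) ^ d₁) • P₁.map Polynomial.C
        + ((X : ℝ[X]) ^ d₂) • P₂.map Polynomial.C + ((X : ℝ[X]) ^ d₃) • Q.map Polynomial.C)).roots.toFinset.filter
          (fun t => 0 < t)).card ≤ 4 := by
  rw [wPencil_posRoots_eq]
  set F := Matrix.det (∑ l, ((X : ℝ[X]) ^ expo e ![d₁, d₂, d₃] l) • (letter J ![P₁, P₂, Q] l).map Polynomial.C)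
    with hF
  have hT : ∀ n, F.coeff n < 0 → n ∈ ({e + d₂, e + d₁, e + e, e + d₃} : Finset ℕ) := fun n hn => wPencil_neg_mem hP₁ hP₂ hQ n hn
  have hgap₁' : ∀ m, u₁ < m → m < v₁ → F.coeff m = 0 := fun m hm1 hm2 =>
    coeff_det_eq_zero_of_forall_ne e _ J _ m fun l l' hm => hgap₁ l l' ⟨by omega, by omega⟩
  have hgap₂' : ∀ m, u₂ < m → m < v₂ → F.coeff m = 0 := fun m hm1 hm2 =>
    coeff_det_eq_zero_of_forall_ne e _ J _ m fun l l' hm => hgap₂ l l' ⟨by omega, by omega⟩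
  have h1 := signVariations_two_pairs_budget F _ hT u₁ v₁ u₂ v₂ h₁ h₁₂ h₂ hu₁ hv₁ hu₂ hv₂ hgap₁' hgap₂'
  have h2 := card_posRoots_le_signVariations F
  have h3 := card_pivotDegrees_le e d₁ d₂ d₃
  omega

/-- evaluation of `expo` on the W data (for the chamber arithmetic) -/
theorem expo_w_cases (l : Option (Fin 3)) :
    expo e ![d₁, d₂, d₃] l = e ∨ expo e ![d₁, d₂, d₃] l = d₁ ∨ expo e ![d₁, d₂, d₃] l = d₂ ∨
      expo e ![d₁, d₂, d₃] l = d₃ := by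
  rcases l with _ | l
  · exact Or.inl rfl
  · fin_cases l
    · exact Or.inr (Or.inl rfl)
    · exact Or.inr (Or.inr (Or.inl rfl))
    · exact Or.inr (Or.inr (Or.inr (by simp [expo])))

/-- **CHAMBER LAW, part 1 (`Z₊ ≤ 6` off the isolated chamber).**  For a `2 × 2` W-configuration with
`d₂ < d₁ < e < d₃` NOT satisfying `e + d₂ < 2d₁ ∧ d₁ + e < d₂ + d₃ ∧ d₂ + d₃ < 2e` (gap form: not `a < g < c < a + g`),
the determinant has at most `6 = 3·2` distinct positive roots — the W-law's conjectured value, attained by the tree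
witness (`WLawTwoWitness`, exponents `(0, 2 | 3 | 5)`). -/
theorem wLawTwo_posRoots_le_six_of_not_chamber (hP₁ : P₁.PosSemidef) (hP₂ : P₂.PosSemidef) (hQ : Q.PosSemidef)
    (h₂₁ : d₂ < d₁) (h₁ₑ : d₁ < e) (hₑ₃ : e < d₃)
    (hch : ¬ (e + d₂ < 2 * d₁ ∧ d₁ + e < d₂ + d₃ ∧ d₂ + d₃ < 2 * e)) :
    ((Matrix.det (((X : ℝ[X]) ^ e) • J.map Polynomial.C + ((X : ℝ[X]) ^ d₁) • P₁.map Polynomial.C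
        + ((X : ℝ[X]) ^ d₂) • P₂.map Polynomial.C + ((X : ℝ[X]) ^ d₃) • Q.map Polynomial.C)).roots.toFinset.filter
          (fun t => 0 < t)).card ≤ 6 := by
  have hmem : ∀ w, w = e + d₂ ∨ w = e + d₁ ∨ w = e + e ∨ w = e + d₃ → w ∈ ({e + d₂, e + d₁, e + e, e + d₃} : Finset ℕ) := by
    intro w hw
    simp only [Finset.mem_insert, Finset.mem_singleton]
    tauto
  -- which of the three consecutive gaps between pivot degrees is free of pair sums
  by_cases hA : ¬ (e + d₂ < 2 * d₁ ∧ 2 * d₁ < e + d₁) ∧ ¬ (e + d₂ < d₂ + d₃ ∧ d₂ + d₃ < e + d₁)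
  · -- gap `(e + d₂, e + d₁)`
    refine wPencil_posRoots_le_six_of_pair hP₁ hP₂ hQ (e + d₂) (e + d₁) (by omega)
      (hmem _ (Or.inl rfl)) (hmem _ (Or.inr (Or.inl rfl))) fun l l' => ?_
    rcases expo_w_cases (e := e) (d₁ := d₁) (d₂ := d₂) (d₃ := d₃) l with h | h | h | h <;>
      rcases expo_w_cases (e := e) (d₁ := d₁) (d₂ := d₂) (d₃ := d₃) l' with h' | h' | h' | h' <;>
        rw [h, h'] <;> omega
  by_cases hB : ¬ (d₁ + e < d₂ + d₃ ∧ d₂ + d₃ < 2 * e) ∧ ¬ (d₁ + d₃ < 2 * e)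
  · -- gap `(e + d₁, 2e)`
    refine wPencil_posRoots_le_six_of_pair hP₁ hP₂ hQ (e + d₁) (e + e) (by omega)
      (hmem _ (Or.inr (Or.inl rfl))) (hmem _ (Or.inr (Or.inr (Or.inl rfl)))) fun l l' => ?_
    rcases expo_w_cases (e := e) (d₁ := d₁) (d₂ := d₂) (d₃ := d₃) l with h | h | h | h <;>
      rcases expo_w_cases (e := e) (d₁ := d₁) (d₂ := d₂) (d₃ := d₃) l' with h' | h' | h' | h' <;>
        rw [h, h'] <;> omega
  by_cases hC : ¬ (2 * e < d₁ + d₃)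
  · -- gap `(2e, e + d₃)`
    refine wPencil_posRoots_le_six_of_pair hP₁ hP₂ hQ (e + e) (e + d₃) (by omega)
      (hmem _ (Or.inr (Or.inr (Or.inl rfl)))) (hmem _ (Or.inr (Or.inr (Or.inr rfl)))) fun l l' => ?_
    rcases expo_w_cases (e := e) (d₁ := d₁) (d₂ := d₂) (d₃ := d₃) l with h | h | h | h <;>
      rcases expo_w_cases (e := e) (d₁ := d₁) (d₂ := d₂) (d₃ := d₃) l' with h' | h' | h' | h' <;>
        rw [h, h'] <;> omega
  -- all three gaps separated: this is exactly the excluded chamber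
  exfalso
  push Not at hA hB hC
  omega

/-- **CHAMBER LAW, part 2 (`Z₊ ≤ 4` on the chamber `g ≤ c ≤ a`).**  If `d₁ + e ≤ d₂ + d₃` and `d₁ + d₃ ≤ 2e`
(with `d₂ < d₁ < e < d₃`), the determinant has at most `4 = 2·2` distinct positive roots. -/
theorem wLawTwo_posRoots_le_four_of_chamber (hP₁ : P₁.PosSemidef) (hP₂ : P₂.PosSemidef) (hQ : Q.PosSemidef)
    (h₂₁ : d₂ < d₁) (h₁ₑ : d₁ < e) (hₑ₃ : e < d₃) (hgc : d₁ + e ≤ d₂ + d₃) (hca : d₁ + d₃ ≤ 2 * e) :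
    ((Matrix.det (((X : ℝ[X]) ^ e) • J.map Polynomial.C + ((X : ℝ[X]) ^ d₁) • P₁.map Polynomial.C
        + ((X : ℝ[X]) ^ d₂) • P₂.map Polynomial.C + ((X : ℝ[X]) ^ d₃) • Q.map Polynomial.C)).roots.toFinset.filter
          (fun t => 0 < t)).card ≤ 4 := by
  have hmem : ∀ w, w = e + d₂ ∨ w = e + d₁ ∨ w = e + e ∨ w = e + d₃ → w ∈ ({e + d₂, e + d₁, e + e, e + d₃} : Finset ℕ) := by
    intro w hw
    simp only [Finset.mem_insert, Finset.mem_singleton]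
    tauto
  refine wPencil_posRoots_le_four_of_pairs hP₁ hP₂ hQ (e + d₂) (e + d₁) (e + e) (e + d₃) (by omega) (by omega)
    (by omega) (hmem _ (Or.inl rfl)) (hmem _ (Or.inr (Or.inl rfl))) (hmem _ (Or.inr (Or.inr (Or.inl rfl))))
    (hmem _ (Or.inr (Or.inr (Or.inr rfl)))) (fun l l' => ?_) (fun l l' => ?_)
  · rcases expo_w_cases (e := e) (d₁ := d₁) (d₂ := d₂) (d₃ := d₃) l with h | h | h | h <;>
      rcases expo_w_cases (e := e) (d₁ := d₁) (d₂ := d₂) (d₃ := d₃) l' with h' | h' | h' | h' <;>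
        rw [h, h'] <;> omega
  · rcases expo_w_cases (e := e) (d₁ := d₁) (d₂ := d₂) (d₃ := d₃) l with h | h | h | h <;>
      rcases expo_w_cases (e := e) (d₁ := d₁) (d₂ := d₂) (d₃ := d₃) l' with h' | h' | h' | h' <;>
        rw [h, h'] <;> omega

end WPencil

end WLawTwoChambers

/-! ## 4. The `n = 2` constant of the W-law lies in `{6, 7, 8}` -/

/-- **`WLawAt 2 8`**: every `2 × 2` W-configuration has at most `8` distinct positive roots — the `K = 3` instance of
the tree's pivot law `Pivot.TwoDescartes.pivotTwo_posRoots_le` (`Z₊ ≤ 2K + 2` for any pivot, conjb-1 g0). -/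
theorem wLawAt_two_eight : WLawAt 2 8 := by
  intro e d₁ d₂ d₃ J P₁ P₂ Q _hJ hP₁ hP₂ hQ _ _ _
  rw [WLawTwoChambers.wPencil_eq]
  have hP : ∀ k : Fin 3, ((![P₁, P₂, Q] : Fin 3 → Matrix (Fin 2) (Fin 2) ℝ) k).PosSemidef := by
    intro k
    fin_cases k
    · simpa using hP₁
    · simpa using hP₂
    · simpa using hQ
  exact Pivot.TwoDescartes.pivotTwo_posRoots_le e ![d₁, d₂, d₃] J ![P₁, P₂, Q] hP

/-- **`¬ WLawAt 2 5`**: the tree witness `WLawTwoWitness` (exponents `e = 3`, `d₁ = 2`, `d₂ = 0`, `d₃ = 5`) has SIX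
distinct positive roots, so the `n = 2` constant is at least `6` (sharpening `not_wLawAt_two_four`). -/
theorem not_wLawAt_two_five : ¬ WLawAt 2 5 := by
  intro h
  have h6 := WLawTwoWitness.six_le_card_posRoots_Fw
  have hJ : (!![620, -260; -260, -2720] : Matrix (Fin 2) (Fin 2) ℝ).IsSymm :=
    Matrix.IsSymm.ext fun i j => by fin_cases i <;> fin_cases j <;> simp
  have h5 := h 3 2 0 5 (!![620, -260; -260, -2720] : Matrix (Fin 2) (Fin 2) ℝ)
    (Matrix.vecMulVec ![(20 : ℝ), 38] ![(20 : ℝ), 38] : Matrix (Fin 2) (Fin 2) ℝ)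
    (Matrix.vecMulVec ![(20 : ℝ), 32] ![(20 : ℝ), 32]
      + Matrix.vecMulVec ![(15 : ℝ), 23] ![(15 : ℝ), 23] : Matrix (Fin 2) (Fin 2) ℝ)
    (Matrix.vecMulVec ![(-9 : ℝ), 20] ![(-9 : ℝ), 20]
      + Matrix.vecMulVec ![(-6 : ℝ), 13] ![(-6 : ℝ), 13] : Matrix (Fin 2) (Fin 2) ℝ)
    hJ WLawTwoWitness.Pw₁_posSemidef WLawTwoWitness.Pw₂_posSemidef WLawTwoWitness.Qw_posSemidef
    (by norm_num) (by norm_num) (by norm_num)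
  exact absurd (h6.trans h5) (by norm_num)

/-- **The `n = 2` W-constant is NOT below six and the chambers off `a < g < c < a + g` never exceed six**: the W-law
`WLawAt 2 6` holds for every exponent configuration outside the chamber `e + d₂ < 2d₁ ∧ d₁ + e < d₂ + d₃ ∧ d₂ + d₃ < 2e`
(restatement of `wLawTwo_posRoots_le_six_of_not_chamber` with the symmetric-`J` hypothesis of `WLawAt`, unused). -/
theorem wLawAt_two_six_off_chamber (e d₁ d₂ d₃ : ℕ) (J P₁ P₂ Q : Matrix (Fin 2) (Fin 2) ℝ)
    (hP₁ : P₁.PosSemidef) (hP₂ : P₂.PosSemidef) (hQ : Q.PosSemidef) (h₂₁ : d₂ < d₁) (h₁ₑ : d₁ < e) (hₑ₃ : e < d₃)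
    (hch : ¬ (e + d₂ < 2 * d₁ ∧ d₁ + e < d₂ + d₃ ∧ d₂ + d₃ < 2 * e)) :
    ((Matrix.det (((Polynomial.X : Polynomial ℝ) ^ e) • J.map Polynomial.C
        + ((Polynomial.X : Polynomial ℝ) ^ d₁) • P₁.map Polynomial.C
        + ((Polynomial.X : Polynomial ℝ) ^ d₂) • P₂.map Polynomial.C
        + ((Polynomial.X : Polynomial ℝ) ^ d₃) • Q.map Polynomial.C)).roots.toFinset.filter
          (fun t => 0 < t)).card ≤ 6 :=
  WLawTwoChambers.wLawTwo_posRoots_le_six_of_not_chamber hP₁ hP₂ hQ h₂₁ h₁ₑ hₑ₃ hch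

end Summit.ValiantsHypothesis.ValiantsHypothesis.Theorems.LacunarySymmetroidMatrixDescartes
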